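import Mathlib
import HarnessLib
import Summits.ABC.ABC.Theses.CongruentialReceptacle
import Summits.ABC.ABC.Theorems.CongruentialReceptacleCompactBalanceTransferPowerDeep
import Summits.ABC.ABC.Theorems.CompactBalanceTransfer.Negative.DepthCellDissolution

/-!
# Crux `CompactBalanceTransfer` (stmt-ABC-1725) — window transfer, part 1: the bookkeeping engine

Support file (`--supports stmt-ABC-1725`) of the line lead `prover-line-stmt-ABC-1725-c8-0` (2026-08-17) for the
registered skeleton `Cruxes/CompactBalanceTransfer/Lines/birth.lean` of the crux
`CompactBalanceTransfer := H → ABC`, `H` = abc on every compactly balanced cell `{min(a,b) ≥ κc}`.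

This is the first of three files (`…WindowEngine`, `…WindowUp`, `…WindowDown`) that kernel-check the quantitative
WINDOW-TRANSFER SCHEMA of the crux-strategist's census (`Cruxes/CompactBalanceTransfer/STRATEGY-CENSUS.md` §3 S5,
Claims A/B, recorded there as "a theorem-schema; elementary, not formalised here"), whose two QUALITATIVE halves are
the landed `QuarterWindowGivesCrux` (balance windows inside the compact cell) and `Negative.DepthCellDissolution`
(linear depth cells). Notation: height `h = log c`, radical-log `r = log rad(abc)`, depth `m = log(c/min(a,b))`.
A WINDOW HYPOTHESIS WITH POLYNOMIAL CONSTANTS is: for every `η ∈ (0,1]` and every abc-triple in a window `W ⊆ {(h,m)}`,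
`h ≤ (1+η)·r + K·η^(−λ)`. The schema says which windows propagate to ALL triples by the two power-map moves over `ℚ`:
* UP (`…WindowUp`, Claim B): `W = {m ≥ h^α}`, move `(aᴺ, cᴺ−aᴺ, cᴺ)` on the small member, works iff `αλ < 1 − α`;
* DOWN (`…WindowDown`, Claim A): `W = {m ≤ h^β}`, move `(bᴺ, cᴺ−bᴺ, cᴺ)` on the large member, works iff `λ(1−β) < β`.
The compactly balanced cell of `H` is the corner `β = 0` of the DOWN family, where the condition is void: this is the
typed form of the census verdict that `H` sits in the one shallow window from which nothing propagates, and of the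
route-level remedy (any Target window growing like `(log c)^β`, `β > λ/(1+λ)`, makes the archimedean transfer a theorem).

THIS FILE: the common real-analysis ENGINE `height_le_of_tolled_window`. A degree-`N` power-map companion of a triple
has height `N·h`, radical `≤ 2N·c^(N−1)·rad(abc)`; the window hypothesis applied to it at `η = ε/(4N)` reads
`N·h ≤ (1+η)(r + log(2N) + (N−1)h) + K·η^(−λ)` — the TOLLED WINDOW INEQUALITY — and if the level is polynomial in the
height, `N ≤ c₁·h^p` with `p·λ < 1`, then the toll `η(N−1)h ≤ εh/4`, the junk `log(2N) = O(log h)` and the constant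
`K(4N/ε)^λ = O(h^(pλ))` are absorbed (`rpow_le_linear_add`, `mul_log_le_linear_add`), leaving `h ≤ (1+ε)r + K₂`.
Also here: the arithmetic of the DOWN companion `(bᴺ, cᴺ − bᴺ, cᴺ)` (`rad_powMapMax_mul_le`: radical toll
`≤ (cᴺ−bᴺ)/a ≤ N·c^(N−1)`; `powMapMax_sub_bounds`: `a·c^(N−1) ≤ cᴺ − bᴺ ≤ N·a·c^(N−1)`, Bernoulli), companion to the
tree's UP lemmas `Negative.powMap_isABCTriple` / `Negative.rad_powMap_mul_le`.
Unconditional; hypotheses spelled out (no `def`s); standard axioms; no named facts.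
-/

-- `Summit.<Summit>.<Problem>`: for the single-conjunct summit `ABC` the duplicate `ABC.ABC` is mandated.
set_option linter.dupNamespace false

namespace Summit.ABC.ABC.Theorems.CompactBalanceTransfer.WindowTransfer

open Literature.NumberTheory.DiophantineGeometry
open Summit.ABC.ABC.Theses.CongruentialReceptacle
open Summit.ABC.ABC.Theorems.CompactBalanceTransfer.PowerDeep
open Summit.ABC.ABC.Theorems.CompactBalanceTransfer.Negative

/-! ### The bookkeeping engine: a tolled window inequality at level `N ≤ c₁·h^p` with `p·λ < 1` gives abc -/

/-- Young-type absorption of a sub-linear power: for `0 ≤ θ < 1`, `0 ≤ A` and `0 < δ` there is `Y` with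
`A·h^θ ≤ δ·h + Y` for all `h > 0`. [folklore] -/
theorem rpow_le_linear_add {A θ δ : ℝ} (hA : 0 ≤ A) (hθ : 0 ≤ θ) (hθ1 : θ < 1) (hδ : 0 < δ) :
    ∃ Y : ℝ, ∀ h : ℝ, 0 < h → A * h ^ θ ≤ δ * h + Y := by
  set A₁ : ℝ := A + 1 with hA₁def
  have hA₁ : 0 < A₁ := by rw [hA₁def]; linarith
  have h1θ : 0 < 1 - θ := by linarith
  set h₀ : ℝ := (A₁ / δ) ^ (1 / (1 - θ)) with hh₀def
  have hh₀ : 0 < h₀ := Real.rpow_pos_of_pos (div_pos hA₁ hδ) _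
  refine ⟨A₁ * h₀ ^ θ, fun h hh => ?_⟩
  have hAle : A * h ^ θ ≤ A₁ * h ^ θ :=
    mul_le_mul_of_nonneg_right (by rw [hA₁def]; linarith) (Real.rpow_nonneg hh.le _)
  refine le_trans hAle ?_
  rcases le_or_gt h h₀ with hle | hlt
  · -- small `h`: `h^θ ≤ h₀^θ`
    have h1 : h ^ θ ≤ h₀ ^ θ := Real.rpow_le_rpow hh.le hle hθ
    have h2 : A₁ * h ^ θ ≤ A₁ * h₀ ^ θ := mul_le_mul_of_nonneg_left h1 hA₁.le
    have h3 : 0 ≤ δ * h := by positivity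
    linarith
  · -- large `h`: `h^θ = h^(θ-1)·h ≤ h₀^(θ-1)·h` and `A₁·h₀^(θ-1) = δ`
    have e1 : h ^ θ = h ^ (θ - 1) * h := by
      rw [Real.rpow_sub_one hh.ne', div_mul_cancel₀ _ hh.ne']
    have h1 : h ^ (θ - 1) ≤ h₀ ^ (θ - 1) :=
      Real.rpow_le_rpow_of_nonpos hh₀ hlt.le (by linarith)
    have e2 : h₀ ^ (θ - 1) = δ / A₁ := by
      rw [hh₀def, ← Real.rpow_mul (div_pos hA₁ hδ).le]
      have : 1 / (1 - θ) * (θ - 1) = -1 := by field_simp; ring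
      rw [this, Real.rpow_neg_one, inv_div]
    have h2 : A₁ * h ^ θ ≤ δ * h := by
      rw [e1]
      calc A₁ * (h ^ (θ - 1) * h) ≤ A₁ * (h₀ ^ (θ - 1) * h) := by
            apply mul_le_mul_of_nonneg_left _ hA₁.le
            exact mul_le_mul_of_nonneg_right h1 hh.le
        _ = δ * h := by rw [e2]; field_simp
    have h3 : 0 ≤ A₁ * h₀ ^ θ := mul_nonneg hA₁.le (Real.rpow_nonneg hh₀.le _)
    linarith

/-- Logarithms are absorbed linearly: for `0 ≤ p` and `0 < δ` there is `Y` with `p·log h ≤ δ·h + Y` for all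
`h > 0`. [folklore] -/
theorem mul_log_le_linear_add {p δ : ℝ} (hp : 0 ≤ p) (hδ : 0 < δ) :
    ∃ Y : ℝ, ∀ h : ℝ, 0 < h → p * Real.log h ≤ δ * h + Y := by
  rcases hp.eq_or_lt with rfl | hp'
  · exact ⟨0, fun h _ => by simp; positivity⟩
  set d : ℝ := δ / p with hddef
  have hd : 0 < d := div_pos hδ hp'
  refine ⟨p * (-1 - Real.log d), fun h hh => ?_⟩
  have h1 : Real.log h = Real.log (d * h) - Real.log d := by
    rw [Real.log_mul hd.ne' hh.ne']; ring
  have h2 : Real.log (d * h) ≤ d * h - 1 := Real.log_le_sub_one_of_pos (mul_pos hd hh)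
  have h3 : p * Real.log h ≤ p * (d * h - 1 - Real.log d) := by
    apply mul_le_mul_of_nonneg_left _ hp; linarith
  have e : p * (d * h) = δ * h := by rw [hddef]; field_simp
  nlinarith [h3, e]


/-- **The engine.** Fix `0 < ε ≤ 1/2`, `K, λ, p ≥ 0` with `p·λ < 1` and `c₁ > 0`. There is a constant `K₂` such that
whenever a height `h > 0`, a radical-log `r ≥ 0` and a level `1 ≤ N ≤ c₁·h^p` satisfy the TOLLED WINDOW INEQUALITY
`N·h ≤ (1 + η)(r + log(2N) + (N−1)·h) + K·η^(−λ)` with `η = ε/(4N)` (this is what an abc-hypothesis with constants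
`K·η^(−λ)`, applied to a degree-`N` power-map companion of height `N·h` and radical `≤ 2N·c^(N−1)·rad`, delivers), then
`h ≤ (1+ε)·r + K₂`. Bookkeeping: the toll `η(N−1)h ≤ εh/4`, the junk `log(2N) ≤ log(2c₁) + p·log h`, and the constant
`K·(4N/ε)^λ ≤ K(4c₁/ε)^λ·h^(pλ)` with `pλ < 1` are all absorbed into `εh/2 + O(1)`. [folklore] -/
theorem height_le_of_tolled_window {ε K lam p c₁ : ℝ} (hε : 0 < ε) (hε2 : ε ≤ 1 / 2) (hK : 0 ≤ K)
    (hlam : 0 ≤ lam) (hp : 0 ≤ p) (hpl : p * lam < 1) (hc₁ : 0 < c₁) :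
    ∃ K₂ : ℝ, ∀ h r N : ℝ, 0 < h → 0 ≤ r → 1 ≤ N → N ≤ c₁ * h ^ p →
      N * h ≤ (1 + ε / (4 * N)) * (r + Real.log (2 * N) + (N - 1) * h) + K * (ε / (4 * N)) ^ (-lam) →
        h ≤ (1 + ε) * r + K₂ := by
  set A : ℝ := K * (4 * c₁ / ε) ^ lam with hAdef
  have hA : 0 ≤ A := mul_nonneg hK (Real.rpow_nonneg (by positivity) _)
  obtain ⟨Y₁, hY₁⟩ := rpow_le_linear_add hA (mul_nonneg hp hlam) hpl (by positivity : (0 : ℝ) < ε / 8)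
  obtain ⟨Y₂, hY₂⟩ := mul_log_le_linear_add hp (by positivity : (0 : ℝ) < ε / 16)
  set K₁ : ℝ := (1 + ε / 4) * (Real.log (2 * c₁) + Y₂) + Y₁ with hK₁def
  have h1ε : (0 : ℝ) < 1 - ε / 2 := by linarith
  refine ⟨K₁ / (1 - ε / 2), fun h r N hh hr hN hNle hmain => ?_⟩
  have hNpos : (0 : ℝ) < N := by linarith
  set η : ℝ := ε / (4 * N) with hηdef
  have hη : 0 < η := by positivity
  have hηle : η ≤ ε / 4 := by
    rw [hηdef, div_le_div_iff₀ (by positivity) (by positivity)]; nlinarith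
  -- Step 1: isolate `h(1 − η(N−1))`
  have hstep1 : h * (1 - η * (N - 1)) ≤ (1 + η) * (r + Real.log (2 * N)) + K * η ^ (-lam) := by
    have e1 : (1 + η) * (r + Real.log (2 * N) + (N - 1) * h) =
        (1 + η) * (r + Real.log (2 * N)) + (N * h - h * (1 - η * (N - 1))) := by ring
    linarith [hmain, e1]
  -- Step 2: the toll `η(N−1) ≤ ε/4`
  have htoll : η * (N - 1) ≤ ε / 4 := by
    have h1 : η * (N - 1) ≤ η * N := by nlinarith
    have h2 : η * N = ε / 4 := by rw [hηdef]; field_simp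
    linarith
  have hstep2 : h * (1 - ε / 4) ≤ h * (1 - η * (N - 1)) := by nlinarith
  -- Step 3: `(1+η)(r+L) ≤ (1+ε/4)(r+L)` (as `L = log(2N) ≥ log 2 > 0`)
  have hLpos : 0 < Real.log (2 * N) := Real.log_pos (by linarith)
  have hstep3 : (1 + η) * (r + Real.log (2 * N)) ≤ (1 + ε / 4) * (r + Real.log (2 * N)) := by
    apply mul_le_mul_of_nonneg_right _ (by linarith); linarith
  -- Step 4: the junk `L ≤ log(2c₁) + p log h ≤ log(2c₁) + (ε/16)h + Y₂`
  have hhp : 0 < h ^ p := Real.rpow_pos_of_pos hh p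
  have hL : Real.log (2 * N) ≤ Real.log (2 * c₁) + p * Real.log h := by
    have h1 : Real.log (2 * N) ≤ Real.log (2 * c₁ * h ^ p) :=
      Real.log_le_log (by positivity) (by nlinarith)
    rw [Real.log_mul (by positivity) hhp.ne', Real.log_rpow hh] at h1
    exact h1
  have hstep4 : (1 + ε / 4) * (r + Real.log (2 * N)) ≤
      (1 + ε / 4) * r + (1 + ε / 4) * (Real.log (2 * c₁) + Y₂) + (ε / 8) * h := by
    have h1 := hY₂ h hh
    have h2 : (1 + ε / 4) * Real.log (2 * N) ≤ (1 + ε / 4) * (Real.log (2 * c₁) + (ε / 16 * h + Y₂)) := by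
      apply mul_le_mul_of_nonneg_left _ (by positivity); linarith
    have h3 : (1 + ε / 4) * (ε / 16 * h) ≤ (ε / 8) * h := by
      have h4 : (0 : ℝ) ≤ ε * h * (1 - ε / 4) :=
        mul_nonneg (mul_pos hε hh).le (by linarith)
      nlinarith [h4]
    linarith [h1, h2, h3]
  -- Step 5: the constant `K η^(−λ) = K (4N/ε)^λ ≤ A h^(pλ) ≤ (ε/8) h + Y₁`
  have hstep5 : K * η ^ (-lam) ≤ (ε / 8) * h + Y₁ := by
    have e1 : η ^ (-lam) = (4 * N / ε) ^ lam := by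
      rw [Real.rpow_neg hη.le, ← Real.inv_rpow hη.le, hηdef, inv_div]
    have h1 : (4 * N / ε) ^ lam ≤ (4 * c₁ / ε * h ^ p) ^ lam := by
      apply Real.rpow_le_rpow (by positivity) _ hlam
      rw [div_mul_eq_mul_div]
      apply div_le_div_of_nonneg_right _ hε.le
      nlinarith
    have e2 : (4 * c₁ / ε * h ^ p) ^ lam = (4 * c₁ / ε) ^ lam * h ^ (p * lam) := by
      rw [Real.mul_rpow (by positivity) hhp.le, ← Real.rpow_mul hh.le]
    have h2 : K * η ^ (-lam) ≤ A * h ^ (p * lam) := by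
      rw [e1, hAdef, mul_assoc, ← e2]
      exact mul_le_mul_of_nonneg_left h1 hK
    exact le_trans h2 (hY₁ h hh)
  -- Step 6: collect
  have hstep6 : h * (1 - ε / 2) ≤ (1 + ε / 4) * r + K₁ := by
    have e : h * (1 - ε / 2) = h * (1 - ε / 4) - (ε / 8) * h - (ε / 8) * h := by ring
    rw [e, hK₁def]
    linarith [hstep1, hstep2, hstep3, hstep4, hstep5]
  -- Step 7: `(1+ε/4) ≤ (1+ε)(1−ε/2)` for `ε ≤ 1/2`, then divide
  have hcoef : (1 + ε / 4) * r ≤ (1 + ε) * (1 - ε / 2) * r := by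
    apply mul_le_mul_of_nonneg_right _ hr
    nlinarith [mul_nonneg hε.le (show (0 : ℝ) ≤ 1 / 2 - ε by linarith)]
  have hfin : (h - (1 + ε) * r) * (1 - ε / 2) ≤ K₁ := by
    have e : (h - (1 + ε) * r) * (1 - ε / 2) = h * (1 - ε / 2) - (1 + ε) * (1 - ε / 2) * r := by ring
    rw [e]; linarith [hstep6, hcoef]
  have := (le_div_iff₀ h1ε).mpr hfin
  linarith

/-! ### The power map on the LARGE member `(bᴺ, cᴺ − bᴺ, cᴺ)` (the DOWN move: depth `≈ m − log N`) -/

/-- Radical bound for the power map on the large member: with `a ≤ b` (irrelevant here) and `cᴺ − bᴺ = a·S`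
(`a = c − b` divides `cᴺ − bᴺ`), `rad(bᴺ · aS · cᴺ) ≤ rad(S)·rad(abc) ≤ S·rad(abc)`, i.e.
`rad(bᴺ (cᴺ − bᴺ) cᴺ) · a ≤ (cᴺ − bᴺ) · rad(abc)`. [folklore] -/
theorem rad_powMapMax_mul_le {a b c : ℕ} (h : IsABCTriple a b c) {n : ℕ} (hn : n ≠ 0) :
    rad (b ^ n) (c ^ n - b ^ n) (c ^ n) * a ≤ (c ^ n - b ^ n) * rad a b c := by
  obtain ⟨ha, hb, habc, _⟩ := h
  have hbc : b < c := by omega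
  have hlt : b ^ n < c ^ n := Nat.pow_lt_pow_left hbc hn
  have hdvd : a ∣ c ^ n - b ^ n := by
    have h := Nat.sub_dvd_pow_sub_pow c b n
    rwa [show c - b = a by omega] at h
  obtain ⟨S, hS⟩ := hdvd
  have hS0 : S ≠ 0 := by
    rintro rfl
    rw [mul_zero] at hS
    omega
  have hrad : rad (b ^ n) (c ^ n - b ^ n) (c ^ n) ≤ S * rad a b c := by
    rw [rad_def, rad_def, hS]
    have h0 : a * b * c ≠ 0 := mul_ne_zero (mul_ne_zero ha.ne' hb.ne') (by omega)
    have hne : (a * b * c) ^ n ≠ 0 := pow_ne_zero n h0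
    have hX : a * b ^ n * c ^ n ∣ (a * b * c) ^ n := by
      rw [mul_pow, mul_pow]
      exact mul_dvd_mul (mul_dvd_mul (dvd_pow_self a hn) dvd_rfl) dvd_rfl
    have h1 : UniqueFactorizationMonoid.radical (a * b ^ n * c ^ n) ∣
        UniqueFactorizationMonoid.radical (a * b * c) := by
      have h := UniqueFactorizationMonoid.radical_dvd_radical hX hne
      rwa [UniqueFactorizationMonoid.radical_pow _ hn] at h
    have h2 : UniqueFactorizationMonoid.radical (b ^ n * (a * S) * c ^ n) ∣
        UniqueFactorizationMonoid.radical S * UniqueFactorizationMonoid.radical (a * b ^ n * c ^ n) := by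
      have e : b ^ n * (a * S) * c ^ n = S * (a * b ^ n * c ^ n) := by ring
      rw [e]
      exact UniqueFactorizationMonoid.radical_mul_dvd
    have h3 : UniqueFactorizationMonoid.radical S ≤ S := Nat.radical_le_self_iff.mpr hS0
    calc UniqueFactorizationMonoid.radical (b ^ n * (a * S) * c ^ n)
        ≤ UniqueFactorizationMonoid.radical S * UniqueFactorizationMonoid.radical (a * b ^ n * c ^ n) :=
          Nat.le_of_dvd (Nat.mul_pos (Nat.radical_pos _) (Nat.radical_pos _)) h2
      _ ≤ S * UniqueFactorizationMonoid.radical (a * b * c) :=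
          Nat.mul_le_mul h3 (Nat.le_of_dvd (Nat.radical_pos _) h1)
  calc rad (b ^ n) (c ^ n - b ^ n) (c ^ n) * a ≤ S * rad a b c * a := Nat.mul_le_mul_right a hrad
    _ = a * S * rad a b c := by ring
    _ = (c ^ n - b ^ n) * rad a b c := by rw [hS]

/-- Bernoulli bookkeeping for the DOWN move, in `ℝ`: for an abc triple and `n ≠ 0`,
`cⁿ − bⁿ ≤ n·a·cⁿ⁻¹` (from `(1 − a/c)ⁿ ≥ 1 − n·a/c`) and `a·cⁿ⁻¹ ≤ cⁿ − bⁿ` (from `(b/c)ⁿ ≤ b/c`). [folklore] -/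
theorem powMapMax_sub_bounds {a b c : ℕ} (h : IsABCTriple a b c) {n : ℕ} (hn : n ≠ 0) :
    (a : ℝ) * (c : ℝ) ^ (n - 1) ≤ (c : ℝ) ^ n - (b : ℝ) ^ n ∧
      (c : ℝ) ^ n - (b : ℝ) ^ n ≤ n * (a : ℝ) * (c : ℝ) ^ (n - 1) := by
  obtain ⟨ha, hb, habc, _⟩ := h
  have haR : (0 : ℝ) < a := by exact_mod_cast ha
  have hbR : (0 : ℝ) < b := by exact_mod_cast hb
  have hcR : (c : ℝ) = a + b := by exact_mod_cast habc.symm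
  have hcpos : (0 : ℝ) < c := by rw [hcR]; positivity
  obtain ⟨k, rfl⟩ : ∃ k, n = k + 1 := ⟨n - 1, (Nat.succ_pred_eq_of_pos (Nat.pos_of_ne_zero hn)).symm⟩
  simp only [Nat.add_sub_cancel]
  set y : ℝ := (b : ℝ) / c with hydef
  have hy0 : 0 ≤ y := div_nonneg hbR.le hcpos.le
  have hy1 : y ≤ 1 := by rw [hydef, div_le_one hcpos, hcR]; linarith
  have hby : (b : ℝ) = y * c := by rw [hydef]; field_simp
  have hbpow : (b : ℝ) ^ (k + 1) = y ^ (k + 1) * (c : ℝ) ^ (k + 1) := by rw [hby, mul_pow]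
  have hck : (c : ℝ) ^ (k + 1) = c * (c : ℝ) ^ k := by ring
  constructor
  · -- `y^(k+1) ≤ y`, so `c^(k+1) - b^(k+1) ≥ c^(k+1) (1 - y) = a c^k`
    have h1 : y ^ (k + 1) ≤ y := pow_le_of_le_one hy0 hy1 (Nat.succ_ne_zero k)
    have h2 : y ^ (k + 1) * (c : ℝ) ^ (k + 1) ≤ y * (c : ℝ) ^ (k + 1) :=
      mul_le_mul_of_nonneg_right h1 (by positivity)
    have e : (a : ℝ) * (c : ℝ) ^ k = (c : ℝ) ^ (k + 1) - y * (c : ℝ) ^ (k + 1) := by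
      have h3 : y * (c : ℝ) ^ (k + 1) = (b : ℝ) * (c : ℝ) ^ k := by rw [hck, ← mul_assoc, ← hby]
      rw [h3, hck, hcR]; ring
    rw [hbpow, e]; linarith
  · -- Bernoulli: `1 - (k+1) x ≤ (1 - x)^(k+1) = y^(k+1)` with `x = a/c`
    set x : ℝ := (a : ℝ) / c with hxdef
    have hx0 : 0 ≤ x := div_nonneg haR.le hcpos.le
    have hyx : y = 1 + (-x) := by
      rw [hydef, hxdef, hcR]; field_simp; ring
    have hB : 1 + ((k + 1 : ℕ) : ℝ) * (-x) ≤ (1 + (-x)) ^ (k + 1) :=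
      one_add_mul_le_pow (by linarith) (k + 1)
    rw [← hyx] at hB
    have h2 : (1 - ((k + 1 : ℕ) : ℝ) * x) * (c : ℝ) ^ (k + 1) ≤ y ^ (k + 1) * (c : ℝ) ^ (k + 1) :=
      mul_le_mul_of_nonneg_right (by linarith) (by positivity)
    have e : ((k + 1 : ℕ) : ℝ) * (a : ℝ) * (c : ℝ) ^ k =
        (c : ℝ) ^ (k + 1) - (1 - ((k + 1 : ℕ) : ℝ) * x) * (c : ℝ) ^ (k + 1) := by
      rw [hck, hxdef]; field_simp; ring
    rw [hbpow, e]; linarith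

/-- **Registered sub-goal `tolledWindowEngine` (closed form of `height_le_of_tolled_window`).** [folklore] -/
theorem tolledWindowEngine : ∀ ε K lam p c₁ : ℝ, 0 < ε → ε ≤ 1 / 2 → 0 ≤ K → 0 ≤ lam → 0 ≤ p → p * lam < 1 →
    0 < c₁ → ∃ K₂ : ℝ, ∀ h r N : ℝ, 0 < h → 0 ≤ r → 1 ≤ N → N ≤ c₁ * h ^ p →
      N * h ≤ (1 + ε / (4 * N)) * (r + Real.log (2 * N) + (N - 1) * h) + K * (ε / (4 * N)) ^ (-lam) →
        h ≤ (1 + ε) * r + K₂ :=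
  fun _ _ _ _ _ hε hε2 hK hlam hp hpl hc₁ => height_le_of_tolled_window hε hε2 hK hlam hp hpl hc₁

end Summit.ABC.ABC.Theorems.CompactBalanceTransfer.WindowTransfer
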